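import Summits.ABC.StewartYu.GluePrincipalToPrime
import HarnessLib

/-!
# WP-S glue, general WP-M exponent: principal reduction with heights `≤ A(m) · p · ∏ log qᵢ`,
# `A(m) ≤ m^{c₄ m}`, ∧ a Theorem-A-shaped bound of envelope `c₁^m m^{c₂ m}` ⇒ the one-prime bound
# with `κ = c₂ + c₄`

`Summits/ABC/StewartYu/GluePrincipalToPrimeGeneral.lean` — cell `abc-stewartyu` (seat p1; theorems
only, no definition, no named fact). A copy of p3's glue `primePadicBoundAt_odd_of_principal`
(`GluePrincipalToPrime.lean`: WP-M with `m^{2m}` ⇒ `κ = c₂ + 2`) in which the heights clause of the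
principal-reduction hypothesis reads `∏ h(αⱼ) ≤ A(m) · p · ∏ log qᵢ` for any `A` with
`A(m) ≤ m^{c₄ m}`, `c₄ ≤ 2` (the exponent clause `|e'ⱼ| ≤ m^{2m} p (∏ log qᵢ) max|eᵢ|` is kept), and
the conclusion is the body of `KappaDoor.FinBoundAt p 4704 (32 c₁) (c₂ + c₄) 2 2 2`. Instances:
WP-M (`A(m) = m^{2m}`, `c₄ = 2`) and WP-M♭ (`PadicLogFormsPrincipalReductionSharp.lean`,
`A(m) = m^m √(m!) ≤ m^{3m/2}`, `c₄ = 3/2`), the latter giving the rung `rad^{5/2+ε}`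
(`PadicCW77EpsShapeFiveHalves.lean`). Book-keeping exactly as in `Glue.bookkeeping`, with
`log(n^{c₄ n}) = c₄ n log n ≤ 2n²`. Everything is [folklore].
-/

noncomputable section

open Finset Real Height
open Literature.NumberTheory.DiophantineGeometry

namespace Summit.ABC.StewartYu

namespace GlueGeneral

open Glue

/-- The real-arithmetic heart of the glue, general WP-M exponent `c₄` (copy of `Glue.bookkeeping`). With `n ≥ 1`, `p ≥ 3`, `Ω > 0`, `L_Q, L_B ≥ 1`,
`1 ≤ lp`, `1 + lp ≤ 2√p`: if `0 ≤ Cn ≤ c₁ⁿ n^{c₂ n}`, `0 ≤ PV ≤ 2ⁿ n^{c₄ n} p Ω`,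
`0 ≤ L2V ≤ (2n²+n+2) + lp + L_Q`, `0 ≤ W ≤ 2n² + lp + L_Q + L_B` and `v ≤ Cn · PV · ((W + L2V) · L2V)`,
then `v ≤ 4704 (32c₁)ⁿ n^{(c₂+c₄)n} p² Ω L_B² L_Q²`. [folklore] -/
theorem bookkeeping_general {n : ℕ} {p c₁ c₂ c₄ Cn PV L2V W v Ω LQ LB lp : ℝ} (hn : 1 ≤ n) (hp : 3 ≤ p)
    (hc₁ : 1 ≤ c₁) (hΩ : 0 < Ω) (hLQ : 1 ≤ LQ) (hLB : 1 ≤ LB)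
    (hlp1 : 1 ≤ lp) (hlp : 1 + lp ≤ 2 * Real.sqrt p)
    (hCn : Cn ≤ c₁ ^ n * (n : ℝ) ^ (c₂ * n))
    (hPV0 : 0 ≤ PV) (hPV : PV ≤ 2 ^ n * (n : ℝ) ^ (c₄ * n) * p * Ω)
    (hL2V0 : 0 ≤ L2V) (hL2V : L2V ≤ (2 * (n : ℝ) ^ 2 + n + 2) + lp + LQ)
    (hW0 : 0 ≤ W) (hW : W ≤ 2 * (n : ℝ) ^ 2 + lp + LQ + LB)
    (hv : v ≤ Cn * PV * ((W + L2V) * L2V)) :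
    v ≤ 4704 * (32 * c₁) ^ n * (n : ℝ) ^ ((c₂ + c₄) * n) * p ^ 2 * Ω * LB ^ 2 * LQ ^ 2 := by
  have hn0 : (0 : ℝ) < n := by exact_mod_cast (show 0 < n by omega)
  have hn1 : (1 : ℝ) ≤ n := by exact_mod_cast hn
  have hp0 : 0 < p := by linarith
  have hsq : Real.sqrt p ^ 2 = p := Real.sq_sqrt hp0.le
  have hs0 : 0 ≤ Real.sqrt p := Real.sqrt_nonneg p
  set a : ℝ := 2 * (n : ℝ) ^ 2 + n + 2 with ha
  set b : ℝ := 4 * (n : ℝ) ^ 2 + n + 2 with hb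
  have hn2 : (0 : ℝ) ≤ (n : ℝ) ^ 2 := sq_nonneg _
  have ha1 : 1 ≤ a := by rw [ha]; linarith
  have hb1 : 1 ≤ b := by rw [hb]; linarith
  -- `L2V ≤ 2 a (1 + lp) LQ`
  have hL2V' : L2V ≤ 2 * a * (1 + lp) * LQ := by
    have h1 : a + lp ≤ a * (1 + lp) := add_le_mul_one_add ha1 (by linarith)
    have h1' : 1 ≤ a * (1 + lp) := one_le_mul_of_one_le_of_one_le ha1 (by linarith)
    have h2 : a * (1 + lp) + LQ ≤ a * (1 + lp) * (1 + LQ) := add_le_mul_one_add h1' (by linarith)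
    have h3 : a * (1 + lp) * (1 + LQ) ≤ a * (1 + lp) * (2 * LQ) :=
      mul_le_mul_of_nonneg_left (by linarith) (by linarith)
    linarith
  -- `W + L2V ≤ 6 b (1 + 2 lp) LQ LB`
  have hWL : W + L2V ≤ 6 * b * (1 + 2 * lp) * LQ * LB := by
    have h0 : W + L2V ≤ b + 2 * lp + 2 * LQ + LB := by rw [hb]; linarith
    have h1 : b + 2 * lp ≤ b * (1 + 2 * lp) := add_le_mul_one_add hb1 (by linarith)
    have h1' : 1 ≤ b * (1 + 2 * lp) := one_le_mul_of_one_le_of_one_le hb1 (by linarith)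
    have h2 : b * (1 + 2 * lp) + 2 * LQ ≤ b * (1 + 2 * lp) * (1 + 2 * LQ) :=
      add_le_mul_one_add h1' (by linarith)
    have h2' : 1 ≤ b * (1 + 2 * lp) * (1 + 2 * LQ) :=
      one_le_mul_of_one_le_of_one_le h1' (by linarith)
    have h3 : b * (1 + 2 * lp) * (1 + 2 * LQ) + LB ≤ b * (1 + 2 * lp) * (1 + 2 * LQ) * (1 + LB) :=
      add_le_mul_one_add h2' (by linarith)
    have h4 : b * (1 + 2 * lp) * (1 + 2 * LQ) * (1 + LB) ≤ b * (1 + 2 * lp) * (3 * LQ) * (2 * LB) := by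
      have hb0 : 0 ≤ b * (1 + 2 * lp) := mul_nonneg (by linarith) (by linarith)
      apply mul_le_mul _ (by linarith) (by linarith) (by positivity)
      exact mul_le_mul_of_nonneg_left (by linarith) hb0
    linarith
  -- `(1 + lp)(1 + 2 lp) ≤ 8 p`
  have hlp2 : (1 + lp) * (1 + 2 * lp) ≤ 8 * p := by
    have h1 : (1 + lp) ^ 2 ≤ (2 * Real.sqrt p) ^ 2 := pow_le_pow_left₀ (by linarith) hlp 2
    have h2 : (2 * Real.sqrt p) ^ 2 = 4 * p := by rw [mul_pow, hsq]; norm_num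
    have h3 : (1 + lp) * (1 + 2 * lp) ≤ (1 + lp) * (2 * (1 + lp)) :=
      mul_le_mul_of_nonneg_left (by linarith) (by linarith)
    have h4 : (1 + lp) * (2 * (1 + lp)) = 2 * (1 + lp) ^ 2 := by ring
    linarith
  -- the product of the two logarithmic factors
  have hprod : (W + L2V) * L2V ≤ 96 * (a * b) * p * LQ ^ 2 * LB := by
    have h := mul_le_mul hWL hL2V' hL2V0 (by positivity)
    calc (W + L2V) * L2V ≤ (6 * b * (1 + 2 * lp) * LQ * LB) * (2 * a * (1 + lp) * LQ) := h
      _ = 12 * (a * b) * ((1 + lp) * (1 + 2 * lp)) * LQ ^ 2 * LB := by ring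
      _ ≤ 12 * (a * b) * (8 * p) * LQ ^ 2 * LB := by
          have : 0 ≤ 12 * (a * b) := by positivity
          have hL : 0 ≤ LQ ^ 2 * LB := by positivity
          apply mul_le_mul_of_nonneg_right _ (by positivity)
          apply mul_le_mul_of_nonneg_right _ (by positivity)
          exact mul_le_mul_of_nonneg_left hlp2 this
      _ = 96 * (a * b) * p * LQ ^ 2 * LB := by ring
  -- `a b ≤ 49 n⁴ ≤ 49 · 16ⁿ`
  have hab : a * b ≤ 49 * (16 : ℝ) ^ n := by
    have hnn : (n : ℝ) ≤ (n : ℝ) ^ 2 := by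
      rw [sq]; exact le_mul_of_one_le_left hn0.le hn1
    have ha5 : a ≤ 5 * (n : ℝ) ^ 2 := by rw [ha]; linarith
    have hb7 : b ≤ 7 * (n : ℝ) ^ 2 := by rw [hb]; linarith
    have h16 := pow_four_le_sixteen_pow n
    have hn4 : (0 : ℝ) ≤ (n : ℝ) ^ 4 := pow_nonneg hn0.le 4
    calc a * b ≤ (5 * (n : ℝ) ^ 2) * (7 * (n : ℝ) ^ 2) := mul_le_mul ha5 hb7 (by positivity) (by positivity)
      _ = 35 * (n : ℝ) ^ 4 := by ring
      _ ≤ 49 * (16 : ℝ) ^ n := by linarith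
  -- powers of `n`
  have hnpow : (n : ℝ) ^ (c₂ * n) * (n : ℝ) ^ (c₄ * n) = (n : ℝ) ^ ((c₂ + c₄) * n) := by
    rw [← Real.rpow_add hn0]
    congr 1; ring
  have hLB2 : LB ≤ LB ^ 2 := by
    rw [sq]; exact le_mul_of_one_le_left (by linarith) hLB
  -- assemble
  have hA : 0 ≤ c₁ ^ n * (n : ℝ) ^ (c₂ * n) := by positivity
  have hB : 0 ≤ 2 ^ n * (n : ℝ) ^ (c₄ * n) * p * Ω := by positivity
  have hC0 : 0 ≤ (W + L2V) * L2V := by positivity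
  calc v ≤ Cn * PV * ((W + L2V) * L2V) := hv
    _ ≤ (c₁ ^ n * (n : ℝ) ^ (c₂ * n)) * (2 ^ n * (n : ℝ) ^ (c₄ * n) * p * Ω) *
          (96 * (a * b) * p * LQ ^ 2 * LB) := by
        apply mul_le_mul (mul_le_mul hCn hPV hPV0 hA) hprod hC0 (mul_nonneg hA hB)
    _ ≤ (c₁ ^ n * (n : ℝ) ^ (c₂ * n)) * (2 ^ n * (n : ℝ) ^ (c₄ * n) * p * Ω) *
          (96 * (49 * (16 : ℝ) ^ n) * p * LQ ^ 2 * LB ^ 2) := by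
        apply mul_le_mul_of_nonneg_left _ (mul_nonneg hA hB)
        apply mul_le_mul _ hLB2 (by linarith) (by positivity)
        apply mul_le_mul_of_nonneg_right _ (by positivity)
        apply mul_le_mul_of_nonneg_right _ hp0.le
        exact mul_le_mul_of_nonneg_left hab (by norm_num)
    _ = 4704 * (c₁ ^ n * 2 ^ n * (16 : ℝ) ^ n) * ((n : ℝ) ^ (c₂ * n) * (n : ℝ) ^ (c₄ * n)) *
          p ^ 2 * Ω * LB ^ 2 * LQ ^ 2 := by ring
    _ = 4704 * (32 * c₁) ^ n * (n : ℝ) ^ ((c₂ + c₄) * n) * p ^ 2 * Ω * LB ^ 2 * LQ ^ 2 := by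
        rw [hnpow, mul_pow, show (32 : ℝ) ^ n = 2 ^ n * 16 ^ n by rw [← mul_pow]; norm_num]
        ring

end GlueGeneral

open Glue GlueGeneral

/-! ### The glue theorem, general WP-M exponent -/

/-- **WP-S glue, general exponent: principal reduction (heights `≤ A(m) p ∏ log qᵢ`,
`A(m) ≤ m^{c₄ m}`, `c₄ ≤ 2`) ∧ a Theorem-A-shaped bound (envelope `c₁^m m^{c₂ m}`) ⇒ the
prime-argument bound at every odd prime** with `K = 4704`, `L = 32 c₁`, `κ = c₂ + c₄`,
`σ = τ = τ₁ = 2` (the body of `KappaDoor.FinBoundAt p 4704 (32 c₁) (c₂ + c₄) 2 2 2`). For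
`A(m) = m^{2m}`, `c₄ = 2` this is `primePadicBoundAt_odd_of_principal`; book-keeping in
`GlueGeneral.bookkeeping_general`. [folklore] -/
theorem primePadicBoundAt_odd_of_principal_general {A : ℕ → ℝ} {c₄ : ℝ} (hc₄ : c₄ ≤ 2)
    (hAenv : ∀ m, A m ≤ (m : ℝ) ^ (c₄ * m))
    (hM : ∀ (p : ℕ), p.Prime → p ≠ 2 → ∀ (m : ℕ) (q : Fin m → ℕ),
      (∀ i, (q i).Prime) → Function.Injective q → (∀ i, q i ≠ p) →
      ∀ (e : Fin m → ℤ), e ≠ 0 → 1 ≤ padicValRat p (∏ i, (q i : ℚ) ^ e i - 1) →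
      ∃ (α : Fin m → ℚ) (e' : Fin m → ℤ),
        (∀ j, α j ≠ 0 ∧ 1 ≤ padicValRat p (α j - 1)) ∧
        (∀ μ : Fin m → ℤ, ∏ j, α j ^ μ j = 1 → μ = 0) ∧
        (∀ T : Finset (Fin m), T.Nonempty → ¬ IsSquare (∏ j ∈ T, α j)) ∧
        e' ≠ 0 ∧ ∏ i, (q i : ℚ) ^ e i = ∏ j, α j ^ e' j ∧
        (∏ j, logHeight₁ (α j)) ≤ A m * p * ∏ i, Real.log (q i) ∧
        (∀ j, (|e' j| : ℝ) ≤
          (m : ℝ) ^ (2 * m) * p * (∏ i, Real.log (q i)) * (Finset.univ.sup fun i => (e i).natAbs)) ∧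
        (∀ j, Real.log p ≤ 2 * logHeight₁ (α j)))
    {C : ℕ → ℝ} {r : ℕ → ℕ} {c₁ c₂ : ℝ} (hc₁ : 1 ≤ c₁)
    (hC : ∀ m, 0 ≤ C m ∧ C m ≤ c₁ ^ m * (m : ℝ) ^ (c₂ * m))
    (hA : ∀ (p : ℕ), p.Prime → p ≠ 2 →
      ∀ (m : ℕ) (α : Fin m → ℚ) (b : Fin m → ℤ) (V : Fin m → ℝ) (Vmax W : ℝ),
        (∀ j, α j ≠ 0 ∧ 1 ≤ padicValRat p (α j - 1)) →
        (∀ μ : Fin m → ℤ, ∏ j, α j ^ μ j = 1 → μ = 0) →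
        (∀ T : Finset (Fin m), T.Nonempty → ¬ IsSquare (∏ j ∈ T, α j)) →
        (∀ j, logHeight₁ (α j) ≤ V j) → (∀ j, Real.log p ≤ V j) → (∀ j, V j ≤ Vmax) →
        b ≠ 0 → (∀ j, Real.log (max 3 (|b j| : ℝ)) ≤ W) →
        (padicValRat p (∏ j, α j ^ b j - 1) : ℝ) * Real.log p ≤
          C m * (∏ j, V j) * (W + Real.log (2 * Vmax)) * Real.log (2 * Vmax) / Real.log p ^ r m)
    {p : ℕ} (hp : p.Prime) (hp2 : p ≠ 2) (n : ℕ) (q : Fin n → ℕ) (e : Fin n → ℤ)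
    (hq : ∀ i, (q i).Prime) (hinj : Function.Injective q) (hqp : ∀ i, q i ≠ p) (he : e ≠ 0)
    (hne1 : ∏ i, ((q i : ℚ)) ^ e i ≠ 1) :
    (padicValRat p (∏ i, ((q i : ℚ)) ^ e i - 1) : ℝ) ≤
      4704 * (32 * c₁) ^ n * (n : ℝ) ^ ((c₂ + c₄) * n) * (p : ℝ) ^ (2 : ℝ) * (∏ i, Real.log (q i)) *
        Real.log (max 3 ((Finset.univ.sup fun i => (e i).natAbs : ℕ) : ℝ)) ^ 2 *
        Real.log (max 3 (∏ i, ((q i : ℕ) : ℝ))) ^ 2 := by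
  classical
  -- `n ≥ 1` (else `e = 0`)
  have hn : 1 ≤ n := by
    rcases Nat.eq_zero_or_pos n with h0 | h0
    · subst h0; exact absurd (Subsingleton.elim e 0) he
    · exact h0
  have hn0 : (0 : ℝ) < n := by exact_mod_cast (show 0 < n by omega)
  -- `p ≥ 3`
  have hp3 : 3 ≤ p := by
    have := hp.two_le
    omega
  have hp3R : (3 : ℝ) ≤ p := by exact_mod_cast hp3
  have hpR0 : (0 : ℝ) < p := by linarith
  -- the quantities of the statement
  set Ω : ℝ := ∏ i, Real.log (q i) with hΩ
  set P : ℝ := ∏ i, ((q i : ℕ) : ℝ) with hP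
  set B : ℕ := Finset.univ.sup fun i => (e i).natAbs with hB
  set LQ : ℝ := Real.log (max 3 P) with hLQ
  set LB : ℝ := Real.log (max 3 (B : ℝ)) with hLB
  set lp : ℝ := Real.log p with hlp
  have hq2 : ∀ i, 2 ≤ q i := fun i => (hq i).two_le
  have hΩ0 : 0 < Ω := Finset.prod_pos fun i _ => Real.log_pos (by exact_mod_cast hq2 i)
  have hl3 : 1 ≤ Real.log 3 := by
    rw [Real.le_log_iff_exp_le (by norm_num)]
    exact Real.exp_one_lt_d9.le.trans (by norm_num)
  have hLQ1 : 1 ≤ LQ := hl3.trans (Real.log_le_log (by norm_num) (le_max_left _ _))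
  have hLB1 : 1 ≤ LB := hl3.trans (Real.log_le_log (by norm_num) (le_max_left _ _))
  have hlp1 : 1 ≤ lp := hl3.trans (Real.log_le_log (by norm_num) hp3R)
  have hlps : 1 + lp ≤ 2 * Real.sqrt p := by
    have hs : 0 < Real.sqrt p := Real.sqrt_pos.mpr hpR0
    have hlog : Real.log (Real.sqrt p) ≤ Real.sqrt p - 1 := Real.log_le_sub_one_of_pos hs
    have h2 : Real.log (Real.sqrt p) = Real.log p / 2 := Real.log_sqrt hpR0.le
    rw [hlp]; linarith
  have hlogΩ : Real.log Ω ≤ LQ := log_prod_log_le q hq2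
  -- the right-hand side is nonnegative: the case `ord_p ≤ 0`
  have hRHS0 : 0 ≤ 4704 * (32 * c₁) ^ n * (n : ℝ) ^ ((c₂ + c₄) * n) * (p : ℝ) ^ (2 : ℝ) * Ω *
      LB ^ 2 * LQ ^ 2 := by
    have : 0 ≤ (32 * c₁) ^ n := pow_nonneg (by linarith) n
    positivity
  by_cases hv : padicValRat p (∏ i, ((q i : ℚ)) ^ e i - 1) ≤ 0
  · exact le_trans (by exact_mod_cast hv) hRHS0
  have hv1 : 1 ≤ padicValRat p (∏ i, ((q i : ℚ)) ^ e i - 1) := by omega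
  -- WP-M
  obtain ⟨α, e', h1, h2, h3, h4, h5, h6, h7, h8⟩ := hM p hp hp2 n q hq hinj hqp e he hv1
  -- the sizes fed to Theorem A
  set V : Fin n → ℝ := fun j => max (logHeight₁ (α j)) lp with hV
  have hVh : ∀ j, logHeight₁ (α j) ≤ V j := fun j => le_max_left _ _
  have hVp : ∀ j, Real.log p ≤ V j := fun j => le_max_right _ _
  have hV1 : ∀ j, 1 ≤ V j := fun j => hlp1.trans (hVp j)
  have hV2 : ∀ j, V j ≤ 2 * logHeight₁ (α j) := fun j =>
    max_le (by linarith [zero_le_logHeight₁ (α j)]) (h8 j)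
  set PV : ℝ := ∏ j, V j with hPV
  have hPV1 : 1 ≤ PV :=
    Finset.prod_induction _ (fun x => 1 ≤ x) (fun _ _ ha hb => one_le_mul_of_one_le_of_one_le ha hb)
      le_rfl (fun j _ => hV1 j)
  have hVle : ∀ j, V j ≤ PV := fun j => le_prod_of_one_le _ _ (fun i _ => hV1 i) (Finset.mem_univ j)
  have hnc₄ : (0 : ℝ) < (n : ℝ) ^ (c₄ * n) := Real.rpow_pos_of_pos hn0 _
  have hPVle : PV ≤ 2 ^ n * (n : ℝ) ^ (c₄ * n) * p * Ω := by
    calc PV ≤ ∏ j, (2 * logHeight₁ (α j)) :=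
          Finset.prod_le_prod (fun j _ => zero_le_one.trans (hV1 j)) fun j _ => hV2 j
      _ = 2 ^ n * ∏ j, logHeight₁ (α j) := by
          rw [Finset.prod_mul_distrib, Finset.prod_const, Finset.card_univ, Fintype.card_fin]
      _ ≤ 2 ^ n * (A n * p * Ω) := mul_le_mul_of_nonneg_left h6 (by positivity)
      _ ≤ 2 ^ n * ((n : ℝ) ^ (c₄ * n) * p * Ω) :=
          mul_le_mul_of_nonneg_left
            (mul_le_mul_of_nonneg_right (mul_le_mul_of_nonneg_right (hAenv n) hpR0.le) hΩ0.le)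
            (by positivity)
      _ = _ := by ring
  set B' : ℝ := (n : ℝ) ^ (2 * n) * p * Ω * B with hB'
  set W : ℝ := Real.log (max 3 B') with hW
  have hWj : ∀ j, Real.log (max 3 (|e' j| : ℝ)) ≤ W := fun j =>
    Real.log_le_log (lt_of_lt_of_le (by norm_num) (le_max_left _ _)) (max_le_max le_rfl (h7 j))
  -- Theorem A
  have key := hA p hp hp2 n α e' V PV W h1 h2 h3 hVh hVp hVle h4 hWj
  rw [← h5] at key
  -- remove `log p` on both sides
  set L2V : ℝ := Real.log (2 * PV) with hL2V
  have hL2V0 : 0 ≤ L2V := Real.log_nonneg (by linarith)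
  have hW0 : 0 ≤ W := Real.log_nonneg (le_trans (by norm_num) (le_max_left _ _))
  have hCn0 : 0 ≤ C n := (hC n).1
  have hX0 : 0 ≤ C n * PV * (W + L2V) * L2V := by positivity
  have hlppow : 1 ≤ Real.log p ^ r n := one_le_pow₀ hlp1
  set v : ℝ := (padicValRat p (∏ i, ((q i : ℚ)) ^ e i - 1) : ℝ) with hvdef
  have hv0 : 0 ≤ v := by rw [hvdef]; exact_mod_cast (le_trans zero_le_one hv1)
  have hvle : v ≤ C n * PV * ((W + L2V) * L2V) := by
    have h1' : v ≤ v * Real.log p := le_mul_of_one_le_right hv0 hlp1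
    have h2' : C n * PV * (W + L2V) * L2V / Real.log p ^ r n ≤ C n * PV * (W + L2V) * L2V :=
      div_le_self hX0 hlppow
    calc v ≤ v * Real.log p := h1'
      _ ≤ C n * PV * (W + L2V) * L2V / Real.log p ^ r n := key
      _ ≤ C n * PV * (W + L2V) * L2V := h2'
      _ = C n * PV * ((W + L2V) * L2V) := by ring
  -- `L2V ≤ (2n² + n + 2) + lp + LQ`
  have hlogn : Real.log n ≤ n := (Real.log_le_sub_one_of_pos hn0).trans (by linarith)
  have hn2n : Real.log ((n : ℝ) ^ (2 * n)) ≤ 2 * (n : ℝ) ^ 2 := by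
    rw [Real.log_pow]
    have h := mul_le_mul_of_nonneg_left hlogn (by positivity : (0 : ℝ) ≤ ((2 * n : ℕ) : ℝ))
    calc ((2 * n : ℕ) : ℝ) * Real.log n ≤ ((2 * n : ℕ) : ℝ) * n := h
      _ = 2 * (n : ℝ) ^ 2 := by push_cast; ring
  have hlogn0 : 0 ≤ Real.log n := Real.log_nonneg (by exact_mod_cast hn)
  have hnc₄n : Real.log ((n : ℝ) ^ (c₄ * n)) ≤ 2 * (n : ℝ) ^ 2 := by
    rw [Real.log_rpow hn0]
    calc c₄ * n * Real.log n ≤ 2 * n * Real.log n :=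
          mul_le_mul_of_nonneg_right (mul_le_mul_of_nonneg_right hc₄ hn0.le) hlogn0
      _ ≤ 2 * n * n := mul_le_mul_of_nonneg_left hlogn (by positivity)
      _ = 2 * (n : ℝ) ^ 2 := by ring
  have hL2Vle : L2V ≤ (2 * (n : ℝ) ^ 2 + n + 2) + lp + LQ := by
    have hpos : 0 < 2 * PV := by linarith
    have hle : 2 * PV ≤ 2 * 2 ^ n * (n : ℝ) ^ (c₄ * n) * p * Ω := by linarith [hPVle]
    have hnn : (0 : ℝ) < (n : ℝ) ^ (c₄ * n) := hnc₄
    calc L2V ≤ Real.log (2 * 2 ^ n * (n : ℝ) ^ (c₄ * n) * p * Ω) := Real.log_le_log hpos hle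
      _ = Real.log 2 + n * Real.log 2 + Real.log ((n : ℝ) ^ (c₄ * n)) + lp + Real.log Ω := by
          rw [Real.log_mul (by positivity) hΩ0.ne', Real.log_mul (by positivity) hpR0.ne',
            Real.log_mul (by positivity) hnn.ne', Real.log_mul (by norm_num) (by positivity),
            Real.log_pow]
      _ ≤ 1 + n * 1 + 2 * (n : ℝ) ^ 2 + lp + LQ := by
          have h2 : Real.log 2 ≤ 1 := by linarith [Real.log_two_lt_d9]
          have : (n : ℝ) * Real.log 2 ≤ n * 1 := mul_le_mul_of_nonneg_left h2 hn0.le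
          linarith
      _ = (2 * (n : ℝ) ^ 2 + n + 2) + lp + LQ - 1 := by ring
      _ ≤ (2 * (n : ℝ) ^ 2 + n + 2) + lp + LQ := by linarith
  -- `W ≤ 2n² + lp + LQ + LB`
  have hWle : W ≤ 2 * (n : ℝ) ^ 2 + lp + LQ + LB := by
    have hΩ1 : Ω ≤ max 1 Ω := le_max_right _ _
    have hm1 : (1 : ℝ) ≤ max 1 Ω := le_max_left _ _
    have hBle : (B : ℝ) ≤ max 3 (B : ℝ) := le_max_right _ _
    have h3le : (3 : ℝ) ≤ max 3 (B : ℝ) := le_max_left _ _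
    have hnn : (1 : ℝ) ≤ (n : ℝ) ^ (2 * n) := one_le_pow₀ (by exact_mod_cast hn)
    set M : ℝ := (n : ℝ) ^ (2 * n) * p * max 1 Ω * max 3 (B : ℝ) with hM
    have hB'M : B' ≤ M := by
      rw [hB', hM]
      apply mul_le_mul (mul_le_mul_of_nonneg_left hΩ1 (by positivity)) hBle (Nat.cast_nonneg _)
        (by positivity)
    have h3M : (3 : ℝ) ≤ M := by
      rw [hM]
      have h1 : (3 : ℝ) ≤ (n : ℝ) ^ (2 * n) * p := by
        calc (3 : ℝ) = 1 * 3 := by ring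
          _ ≤ (n : ℝ) ^ (2 * n) * p := mul_le_mul hnn hp3R (by norm_num) (by positivity)
      calc (3 : ℝ) = 3 * 1 * 1 := by ring
        _ ≤ (n : ℝ) ^ (2 * n) * p * max 1 Ω * max 3 (B : ℝ) :=
            mul_le_mul (mul_le_mul h1 hm1 zero_le_one (by positivity)) (by linarith) zero_le_one
              (by positivity)
    have hmaxM : max 3 B' ≤ M := max_le h3M hB'M
    have hM0 : 0 < M := by linarith
    have hlogmax1 : Real.log (max 1 Ω) ≤ LQ := by
      rw [hLQ]
      apply Real.log_le_log (by positivity)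
      refine max_le (le_trans (by norm_num) (le_max_left _ _)) (le_trans ?_ (le_max_right _ _))
      exact Finset.prod_le_prod (fun i _ => (Real.log_pos (by exact_mod_cast hq2 i)).le)
        fun i _ => (Real.log_le_sub_one_of_pos (by exact_mod_cast (by linarith [hq2 i] : 0 < q i))).trans
          (by linarith)
    calc W ≤ Real.log M := Real.log_le_log (lt_of_lt_of_le (by norm_num) (le_max_left _ _)) hmaxM
      _ = Real.log ((n : ℝ) ^ (2 * n)) + lp + Real.log (max 1 Ω) + LB := by
          rw [hM, Real.log_mul (by positivity) (by positivity), Real.log_mul (by positivity) (by positivity),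
            Real.log_mul (by positivity) hpR0.ne']
      _ ≤ 2 * (n : ℝ) ^ 2 + lp + LQ + LB := by linarith
  -- conclude
  have hfinal := bookkeeping_general (c₂ := c₂) (c₄ := c₄) hn hp3R hc₁ hΩ0 hLQ1 hLB1 hlp1 hlps
    (hC n).2 (zero_le_one.trans hPV1) hPVle hL2V0 hL2Vle hW0 hWle hvle
  rw [Real.rpow_two]
  exact hfinal

end Summit.ABC.StewartYu

end
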